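import Summits.Ventures.WeilGRH.UniformConductorFloorJointData640Log9
import HarnessLib

/-!
# GRH arm (rh-explicit, venture WeilGRH): kernel check — cells `[176, 352)` of the R = 640 joint cell certificate `certEven640Log9` (t = log 3)

Cell `rh-explicit`, WEIL TRACK — GRH ARM (weil-grh-1, gen9).  `certEven640Log9.cellsRange 176 176` by `decide +kernel` (the zipper `JointCert.cellsLoop` over the cells
`176 ≤ j < 352` of the 704; ≈ 45–70 s); glued with the other four ranges by `JointCert.cellsLoop_spec` in `UniformConductorFloorJointR640Log9Floors.lean`.
No definitions; no named facts; standard axioms. [folklore]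
-/

namespace Summit.Ventures.WeilGRH

namespace UniformFloor

set_option maxHeartbeats 0 in
set_option maxRecDepth 200000 in
/-- Cells `[176, 352)` of `certEven640Log9`. [folklore] -/
theorem certEven640Log9_cellsB : certEven640Log9.cellsRange 176 176 = true := by
  decide +kernel

end UniformFloor

end Summit.Ventures.WeilGRH
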